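import Mathlib
import Summits.Parity.BatemanHorn.Theses.PolynomialMobius
import Summits.Parity.BatemanHorn.Theses.IsogenyRedei
import Summits.Parity.BatemanHorn.Theorems.PolynomialMobiusPolyMobiusTailCoreExact
import Summits.Parity.BatemanHorn.Theorems.PolynomialMobiusPolyMobiusTailStubNonlinearWindowOfLevel
import Summits.Parity.BatemanHorn.Theorems.PolynomialMobiusPolyMobiusTailSummitEquivalence

/-!
# Crux stmt-Parity-0870 `PolyMobiusTail` — registered sub-skeleton of the piece `stub_window_nonlinear`
# (WINDOW of the Möbius tail for systems with a NON-LINEAR member) + the crux skeleton v6 it sits in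
# — v7.1 (lead prover-line-stmt-Parity-0870-c8-0, 2026-08-17T15Z): W1 LANDED and derived; §C summit equivalence

v7.1 = the planner-skel file (v7, @beafb81fe86f, sha 9bfcc353…) with TWO changes and nothing else:
(i) W1 `stub_nonlinear_window_of_level` is no longer a stub — it is the LANDED theorem
`Summit.Parity.BatemanHorn.Theorems.PolyMobiusTail.NonlinearWindow.stub_nonlinear_window_of_level`
(`Theorems/PolynomialMobiusPolyMobiusTailStubNonlinearWindowOfLevel.lean`, lead c8 wave 1: aux stubs
`stub_windowSwap` p166182, `stub_windowMainTerm` p166444, `stub_windowBlocks`/`stub_windowBoxChange` p166244,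
assembly by the lead), consumed BY NAME as `W1_nonlinear_window_of_level_landed` below; registered stubs are
now exactly FIVE: W2 `stub_single_nonlinear_level`, W3 `stub_multi_nonlinear_level`, S4a′ `stub_large_core_small`,
S4b `stub_large_band_three_le`, S2u `stub_window_linear_three_le_uniform` (all open problems in print);
(ii) §C: the landed SUMMIT-EQUIVALENCE certificate (p161759/p161885, `PolyMobiusTail ↔ BatemanHorn`):
the five stubs prove `BatemanHorn` itself (`batemanHorn_of_stubs`).

Planner `planner-skel-stmt-Parity-0870-stub_window_nonl-0` (skeleton registrar, 2026-08-17), on the route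
re-audit instruction "bare side of a bridge split: the OPEN piece `stub_window_nonlinear` has no registered
skeleton or live line" (route PolynomialMobius; the crux is shared verbatim by IsogenyRedei, CyclotomicTower,
CrossedSalie, GaussianFractions).

## The piece, by name

`stub_window_nonlinear` is stub S3 of line `eta-free-multilinear-window` (skeletons v2–v5): for a
Bateman–Horn system with a member of degree `≥ 2`, SOME window `(x^{1-η}, x^{1+θ}]` of the Möbius tail
`Σ_{n≤x} Σ_{dᵢ ∣ fᵢ(n)} ∏ μ(dᵢ) log dᵢ` is `o(x)` (`WindowNonlinear` below, the v5 registered signature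
verbatim).  Skeleton v6 (lead c7, `Lines/stub_large.lean` @2c6605b9dc37, 12:05Z today) re-registered it in the
UNIFORM form S3u `stub_window_nonlinear_uniform` (`∃ c ∈ (0,1)`, window `o(x)` for ALL `θ, η ∈ (0,c]`;
`WindowNonlinearUniform` below, verbatim), which is the form the landed composition
`CoreExact.polyMobiusTail_of_coreSmall` (p158707) consumes and which implies the v5 form
(`windowNonlinear_of_uniform`, proved).  Neither form had a decomposition; this file registers one.

## §A  The registered decomposition of the piece (three NEW stubs; composition PROVED)

The window is a SIGNED LEVEL-OF-DISTRIBUTION statement at the diagonal.  Swapping the sums,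
`Window_{θ,η}(x) = Σ_{x^{1-η} < ∏dᵢ ≤ x^{1+θ}} (∏ μ(dᵢ) log dᵢ) · A_d(x)`, `A_d(x) = #{n ≤ x : dᵢ ∣ fᵢ(n)⁺ ≠ 0 ∀ i}`,
and `A_d(x) = x·G(d) + R_d(x)` with `G(d) = sysDensity f d` (the CRT density, in tree).  The MAIN TERM
`x · Σ_{window} (∏ μ log)(d) G(d)` is `x ·` (a block of the tail of a CONVERGENT series) `= o(x)` by the LANDED
`TypeIMainTerm.tendsto_singularSeries` (the log-weighted singular series of EVERY Bateman–Horn system converges,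
`Theorems/IsogenyRedeiTypeIMainTerm.lean`).  What is left is the discrepancy sum — the engine — which this file
registers separately for the two shapes whose technology differs, plus the theorem-grade transfer:

* W1 `stub_nonlinear_window_of_level` — TRANSFER (theorem-grade, size M/L, every input in tree): for any system
  with a non-linear member, a log-power-saving signed level of distribution of the `∏ μ log`-weighted root-count
  discrepancy on the power window `∏dᵢ ∈ [x^{1-c}, x^{1+c}]` implies the uniform window.  Proof plan: exact swap
  of summation (same `toNat`/`Nat.divisors` convention on both sides, so it is an identity for every `x`), main
  term by `tendsto_singularSeries` (Cauchy tail), `≤ 6c·log x + 1` dyadic blocks each `≤ x/(log x)^A`, `A > 1`.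
* W2 `stub_single_nonlinear_level` — ENGINE, ONE polynomial of degree `≥ 2` (open): the μ-twisted signed level
  of distribution of the root counts `#{n ≤ x : d ∣ f(n)}` around the diagonal `d ≍ x^{1±c}` with a log-power
  saving.  Quadratic `f`: roots of quadratic congruences ↔ ideals of the order of discriminant `disc f`
  (Gauss / Duke–Friedlander–Iwaniec 1995, Tóth 2000: equidistribution to prime moduli, qualitative); after
  Vaughan on `μ(d)` it is Type I = root level beyond `x^{1/2}` and Type II = bilinear forms in root Kloosterman
  fractions — at the POWER window exactly the shapes of the open GaussianFractions items stmt-Parity-12215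
  `RootLevelBeyondHalf` / 12214 `RootFractionsBound` (typed there for `X²+1` with power savings; refuter numerics:
  square-root cancellation).  Degree `≥ 3`: Hooley 1964 gives equidistribution over ALL moduli only; the
  μ-twisted / prime-modulus version is open and tool-less.
* W3 `stub_multi_nonlinear_level` — ENGINE, `k ≥ 2` members one of which is non-linear (open, tool-less):
  CRT-entangled root counts of several polynomials; the tiny-coordinate corner is Bombieri–Vinogradov territory
  (template p146909), the balanced ranges are multilinear Kloosterman fractions with ROOT numerators (cf. S2u and
  BarrierNotesIdeator4 §B20).  Log-power (not power) savings are posited on purpose: the corner with all but one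
  coordinate tiny contains `μ` in arithmetic progressions to small moduli.

Composition `WindowNonlinearUniform_of : W1 → W2 → W3 → WindowNonlinearUniform` is PROVED below (cases `k = 0`
vacuous, `k = 1` → W1∘W2, `k ≥ 2` → W1∘W3); `windowNonlinearUniform_derived` (= S3u verbatim) and
`windowNonlinear_derived` (= the v5 piece verbatim) follow.  No new stub gives the piece, the crux or the summit
on its own (per-stub probes in `Lines/stub_window_nonlinear.md`): W1 is an implication with an open antecedent,
W2/W3 are discrepancy bounds that need W1's main-term input (a landed theorem, but not a one-liner) and cover
disjoint shapes.

## §B  The crux-level skeleton = v6 UNCHANGED IN CONTENT, with S3u now DERIVED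

The three other registered stubs of v6 verbatim (names and signatures identical to the records on
stmt-Parity-0870 — they stay registered): S4a′ `stub_large_core_small` (exact parity core), S4b
`stub_large_band_three_le`, S2u `stub_window_linear_three_le_uniform`; the composition
`PolyMobiusTail_of : …Theses.PolynomialMobius.PolyMobiusTail` (crux BY NAME) := the LANDED
`CoreExact.polyMobiusTail_of_coreSmall` applied to S4a′, S4b, S2u and `windowNonlinearUniform_derived`; twin for
IsogenyRedei; v6's bookkeeping theorems (`stub_large_small_derived`, `stub_large_core_small_of_forall`,
`stub_large_core_small_of_crux`) kept, with S3u supplied by the derived theorem.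
Registered stub set after `skeleton check` = {stub_large_core_small, stub_large_band_three_le,
stub_window_linear_three_le_uniform, stub_nonlinear_window_of_level, stub_single_nonlinear_level,
stub_multi_nonlinear_level} (6); the v6 record `stub_window_nonlinear_uniform` expires because it is now derived
(anyone proving S3u wholesale closes W1–W3's purpose just as well: `PolyMobiusTail_of` only needs the derived
theorem's statement).

Sorries: exactly the six `stub_*` theorems above.

Disproof used (`Cruxes/PolyMobiusTail/Disproof.lean`, sha a1f48fa0…, unchanged since 2026-08-16T06:20Z, §6 Targets
empty): `polyMobiusTail_false_without_nonAssoc` is the only `_false_without_` theorem; W1–W3 keep the FULL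
`IsBatemanHornSystem f` hypothesis (non-association is used by W1's main-term input `tendsto_singularSeries`, whose
proof needs pairwise non-association for the joint Euler product; W3's tuples of associated members would carry a
divisor-function main term).  Landed `Negative/*` checked: the stubs are SIGNED (`polyMobiusTail_abs_false` does not
bite), over ALL divisor tuples (`_primeDivisors_false`), with the tail cut strictly inside `(0,1)` and `η`-uniform
only on `(0,c]`, `c < 1` (`_tight_at_eta_one`, `_allEtaClosed_false` do not bite); `Negative.Equivalence` honoured
(no stub claims more than its slice; the window stubs are parity-free in kind, the parity content stays in S4a′).
-/

open scoped BigOperators Topology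
open Filter Finset Polynomial Asymptotics

namespace Summit.Parity.BatemanHorn.Cruxes.PolyMobiusTail.NonlinearWindow

open Literature.NumberTheory.Sieve
open Summit.Parity.BatemanHorn.Theorems.PolyMobiusTail.EtaFreeWindow

/-! ## §A  The piece `stub_window_nonlinear`, BY NAME, and its registered three-stub decomposition -/

/-- **The piece** (S3 of line `eta-free-multilinear-window`, v5 registered signature verbatim): for a
Bateman–Horn system with a member of degree `≥ 2`, SOME window `(x^{1-η}, x^{1+θ}]` of the Möbius tail is `o(x)`. -/
def WindowNonlinear : Prop :=
  ∀ (k : ℕ) (f : Fin k → ℤ[X]), IsBatemanHornSystem f → (∃ i, 2 ≤ (f i).natDegree) →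
    ∃ θ : ℝ, 0 < θ ∧ θ < 1 ∧ ∃ η : ℝ, 0 < η ∧ η < 1 ∧
      (fun x : ℕ => ∑ n ∈ Finset.Icc 1 x,
        ∑ d ∈ Fintype.piFinset (fun i => (((f i).eval (n : ℤ)).toNat).divisors),
          if (x : ℝ) ^ (1 - η) < ∏ i, (d i : ℝ) ∧ ∏ i, (d i : ℝ) ≤ (x : ℝ) ^ (1 + θ) then
            ∏ i, ((ArithmeticFunction.moebius (d i) : ℝ) * Real.log (d i)) else 0)
        =o[atTop] fun x : ℕ => (x : ℝ)

/-- **The piece in its v6 (live) form** S3u `stub_window_nonlinear_uniform`, verbatim: there is `c ∈ (0,1)` such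
that the window is `o(x)` for ALL `θ, η ∈ (0, c]`. -/
def WindowNonlinearUniform : Prop :=
  ∀ (k : ℕ) (f : Fin k → ℤ[X]), IsBatemanHornSystem f → (∃ i, 2 ≤ (f i).natDegree) →
    ∃ c : ℝ, 0 < c ∧ c < 1 ∧ ∀ θ η : ℝ, 0 < θ → θ ≤ c → 0 < η → η ≤ c →
      (fun x : ℕ => ∑ n ∈ Finset.Icc 1 x,
        ∑ d ∈ Fintype.piFinset (fun i => (((f i).eval (n : ℤ)).toNat).divisors),
          if (x : ℝ) ^ (1 - η) < ∏ i, (d i : ℝ) ∧ ∏ i, (d i : ℝ) ≤ (x : ℝ) ^ (1 + θ) then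
            ∏ i, ((ArithmeticFunction.moebius (d i) : ℝ) * Real.log (d i)) else 0)
        =o[atTop] fun x : ℕ => (x : ℝ)

/-- The uniform (v6) form implies the v5 form (take `θ = η = c`). -/
theorem windowNonlinear_of_uniform (h : WindowNonlinearUniform) : WindowNonlinear := by
  intro k f hf hi
  obtain ⟨c, hc0, hc1, hW⟩ := h k f hf hi
  exact ⟨c, hc0, hc1, c, hc0, hc1, hW c c hc0 le_rfl hc0 le_rfl⟩

/-- **W1 (LANDED by lead c8 — `Theorems/PolynomialMobiusPolyMobiusTailStubNonlinearWindowOfLevel.lean`; no longer a stub,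
consumed BY NAME) · `stub_nonlinear_window_of_level` — TRANSFER: signed level of distribution at the diagonal ⟹ uniform
window (theorem-grade; every input in tree).**  For a Bateman–Horn system `f` with a member of degree `≥ 2`:
IF there are `c > 0`, `A > 1`, `x₀` such that for all real `x ≥ x₀` and all `x^{1-c} ≤ D ≤ D' ≤ 2D`,
`D ≤ x^{1+c}`,
`|Σ_{d : D < ∏dᵢ ≤ D'} (∏ᵢ μ(dᵢ) log dᵢ) · (A_d(x) − x·G(d))| ≤ x/(log x)^A`, where
`A_d(x) = #{1 ≤ n ≤ x : dᵢ ∣ fᵢ(n)⁺ and fᵢ(n)⁺ ≠ 0 for all i}` (the SAME `toNat`/`Nat.divisors` convention as the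
window) and `G(d) = sysDensity f d = #{n mod lcm(d) : dᵢ ∣ fᵢ(n) ∀ i}/lcm(d)`, THEN there is `c' ∈ (0,1)` with the
window `o(x)` for all `θ, η ∈ (0, c']`.
Why true / plan: (1) for every `x`, swapping the two finite sums gives
`Window_{θ,η}(x) = Σ_{x^{1-η} < ∏dᵢ ≤ x^{1+θ}} (∏ μ log)(d) · A_d(x)` exactly (tuples with `A_d(x) ≠ 0` have every
`dᵢ ≤ ∏dᵢ ≤ x^{1+θ}`); (2) `A_d = x·G(d) + (A_d − x·G(d))`; the main term is
`x·(S(⌊x^{1+θ}⌋) − S(⌊x^{1-η}⌋))` with `S(N) = Σ_{m≤N} Σ_{∏dᵢ=m} G(d) ∏ μ(dᵢ) log dᵢ` CONVERGENT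
(`TypeIMainTerm.tendsto_singularSeries`, landed; `Nat.finMulAntidiag` indexing), hence `o(x)` (Cauchy tail);
(3) cover `(x^{1-η}, x^{1+θ}] ⊂ [x^{1-c}, x^{1+c}]` (`θ, η ≤ c' ≤ c`) by `≤ 2(θ+η)log₂x + 1` blocks
`(D, min(2D, x^{1+θ})]` — integer tuples with `D < ∏dᵢ ≤ D'` are exactly those the hypothesis sums — each
`≤ x/(log x)^A`; total `≪ x (log x)^{1-A} = o(x)` since `A > 1`.  Size M/L (Finset bookkeeping + `IsLittleO`).
No Bateman–Horn axiom is used beyond what `tendsto_singularSeries` needs (it needs all of `IsBatemanHornSystem`).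
Sources: BatemanHorn1962 §2; `Theorems/IsogenyRedeiTypeIMainTerm.lean` (`tendsto_singularSeries`);
`CoreExact.uniformWindow_of_le_one` (shape of the conclusion). -/
theorem W1_nonlinear_window_of_level_landed : ∀ (k : ℕ) (f : Fin k → ℤ[X]), IsBatemanHornSystem f →
    (∃ i, 2 ≤ (f i).natDegree) →
    (∃ c : ℝ, 0 < c ∧ ∃ A : ℝ, 1 < A ∧ ∃ x₀ : ℝ, ∀ x D D' : ℝ, x₀ ≤ x → x ^ (1 - c) ≤ D → D ≤ D' →
        D' ≤ 2 * D → D ≤ x ^ (1 + c) →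
        |∑ d ∈ Fintype.piFinset (fun _ : Fin k => Finset.Icc 1 ⌊D'⌋₊),
            (if D < ∏ i, (d i : ℝ) ∧ ∏ i, (d i : ℝ) ≤ D' then
              (∏ i, ((ArithmeticFunction.moebius (d i) : ℝ) * Real.log (d i))) *
                (((((Finset.Icc 1 ⌊x⌋₊).filter (fun n : ℕ =>
                    ∀ i, d i ∈ (((f i).eval (n : ℤ)).toNat).divisors)).card : ℕ) : ℝ) -
                  x * Summit.Parity.BatemanHorn.Theorems.TypeIMainTerm.sysDensity f d)
            else 0)| ≤ x / Real.log x ^ A) →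
    ∃ c : ℝ, 0 < c ∧ c < 1 ∧ ∀ θ η : ℝ, 0 < θ → θ ≤ c → 0 < η → η ≤ c →
      (fun x : ℕ => ∑ n ∈ Finset.Icc 1 x,
        ∑ d ∈ Fintype.piFinset (fun i => (((f i).eval (n : ℤ)).toNat).divisors),
          if (x : ℝ) ^ (1 - η) < ∏ i, (d i : ℝ) ∧ ∏ i, (d i : ℝ) ≤ (x : ℝ) ^ (1 + θ) then
            ∏ i, ((ArithmeticFunction.moebius (d i) : ℝ) * Real.log (d i)) else 0)
        =o[atTop] fun x : ℕ => (x : ℝ) :=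
  Summit.Parity.BatemanHorn.Theorems.PolyMobiusTail.NonlinearWindow.stub_nonlinear_window_of_level

/-- **W2 · `stub_single_nonlinear_level` — ENGINE for ONE polynomial of degree `≥ 2` (open).**  For `f = (f₀)` a
Bateman–Horn system with `deg f₀ ≥ 2` there are `c > 0`, `A > 1`, `x₀` such that for `x ≥ x₀`,
`x^{1-c} ≤ D ≤ D' ≤ 2D`, `D ≤ x^{1+c}`:
`|Σ_{D < d ≤ D'} μ(d) log d · (#{1 ≤ n ≤ x : d ∣ f₀(n)⁺ ≠ 0} − x·ρ(d)/d)| ≤ x/(log x)^A`, `ρ(d) = #{ν mod d : f₀(ν) ≡ 0}`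
(written in the `Fin 1`-tuple form that W1 consumes: `G(d) = sysDensity f d = ρ(d)/d`).  The μ-TWISTED SIGNED LEVEL
OF DISTRIBUTION of the roots of `f₀` at moduli `d ≍ x^{1±c}` (the diagonal), with only a log-power saving asked
(trivial bound `≍ x log x` per block; the random model gives `√D·x^{o(1)}`).  Below the diagonal `A_d − xρ/d =
Σ_ν (ψ(−ν/d) − ψ((x−ν)/d))`, above it `A_d ∈ {0,…,ρ(d)}` counts roots in the initial segment `[1,x]` of relative
length `x/d ≥ x^{-c}`: either way, after Vaughan on `μ`, Type I = root equidistribution over multiples of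
`m ≤ x^{1/2+}` (level beyond `1/2`: shape of stmt-Parity-12215 `RootLevelBeyondHalf`), Type II = bilinear forms in
root Kloosterman fractions `e(hν/(mn)) = e(hν_m n̄/m)e(hν_n m̄/n)` (shape of stmt-Parity-12214 `RootFractionsBound`,
Duke–Friedlander–Iwaniec 1997 / Bettin–Chandee with ENTANGLED numerators) — for quadratic `f₀` a programme
(GaussianFractions types it for `X²+1` at the LOG window; here the POWER window, where Grimmelt–Merikoski's
Type II `MN < X` does not reach), for `deg f₀ ≥ 3` no tool (Hooley 1964: all moduli only).  Why it might fail: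
hardness, not falsity — equidistribution of roots to prime moduli with ANY quantitative saving beyond DFI/Tóth's
is open even for `X²+1`; for cubics even the qualitative prime-modulus statement is open.  Size: XL / open-problem.
Sources: DukeFriedlanderIwaniec1995, Toth2000 (IMRN), Hooley1964, DukeFriedlanderIwaniec1997, BettinChandee2018,
arXiv:2505.00493, route GaussianFractions items 12214/12215/12220, `Lines/stub_window_linear_le_one_REPORT-c6.md` §S3. -/
theorem stub_single_nonlinear_level : ∀ (f : Fin 1 → ℤ[X]), IsBatemanHornSystem f → 2 ≤ (f 0).natDegree →
    ∃ c : ℝ, 0 < c ∧ ∃ A : ℝ, 1 < A ∧ ∃ x₀ : ℝ, ∀ x D D' : ℝ, x₀ ≤ x → x ^ (1 - c) ≤ D → D ≤ D' →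
      D' ≤ 2 * D → D ≤ x ^ (1 + c) →
      |∑ d ∈ Fintype.piFinset (fun _ : Fin 1 => Finset.Icc 1 ⌊D'⌋₊),
          (if D < ∏ i, (d i : ℝ) ∧ ∏ i, (d i : ℝ) ≤ D' then
            (∏ i, ((ArithmeticFunction.moebius (d i) : ℝ) * Real.log (d i))) *
              (((((Finset.Icc 1 ⌊x⌋₊).filter (fun n : ℕ =>
                  ∀ i, d i ∈ (((f i).eval (n : ℤ)).toNat).divisors)).card : ℕ) : ℝ) -
                x * Summit.Parity.BatemanHorn.Theorems.TypeIMainTerm.sysDensity f d)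
          else 0)| ≤ x / Real.log x ^ A := by
  sorry

/-- **W3 · `stub_multi_nonlinear_level` — ENGINE for `k ≥ 2` members, one of degree `≥ 2` (open, tool-less).**
For a Bateman–Horn system `f = (f₁,…,f_k)`, `k ≥ 2`, with some `deg fᵢ ≥ 2`, there are `c > 0`, `A > 1`, `x₀` with,
for `x ≥ x₀`, `x^{1-c} ≤ D ≤ D' ≤ 2D`, `D ≤ x^{1+c}`:
`|Σ_{d : D < ∏dᵢ ≤ D'} (∏ μ(dᵢ) log dᵢ)(A_d(x) − x·G(d))| ≤ x/(log x)^A`, `A_d(x) = #{1 ≤ n ≤ x : dᵢ ∣ fᵢ(n)⁺ ≠ 0 ∀i}`,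
`G(d) = sysDensity f d` (CRT density).  The simultaneous root conditions are CRT-entangled across the members
(e.g. `(X, X²+1)`: `n = d₁m`, `d₂ ∣ d₁²m² + 1`); the corner where all coordinates but one have product `≤ x^σ`
is Bombieri–Vinogradov territory (template: the pair corner p146909, `bombieriVinogradov_moebius`) and is why only
LOG-power savings are posited (a tiny coordinate turns its partner's sum into `μ·log` in progressions to small
moduli); the balanced ranges are multilinear Kloosterman-fraction sums whose numerators are ROOTS of the
non-linear member — no bound in print (cf. S2u for the all-linear analogue, census gen 4 S12a,
BarrierNotesIdeator4 §B20).  Why it might fail: hardness, not falsity (consistent with the random model; implied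
slice-wise by Λ-Bateman–Horn + core + band, `Negative.Equivalence`).  Size: XL / open-problem.
Sources: DukeFriedlanderIwaniec1997, arXiv:2008.09905 §1.3, `Cruxes/PolyMobiusTail/STRATEGY-CENSUS.md` gen 4,
`Cruxes/PolyMobiusTail/BarrierNotesIdeator4.md` §B20. -/
theorem stub_multi_nonlinear_level : ∀ (k : ℕ) (f : Fin k → ℤ[X]), IsBatemanHornSystem f → 2 ≤ k →
    (∃ i, 2 ≤ (f i).natDegree) →
    ∃ c : ℝ, 0 < c ∧ ∃ A : ℝ, 1 < A ∧ ∃ x₀ : ℝ, ∀ x D D' : ℝ, x₀ ≤ x → x ^ (1 - c) ≤ D → D ≤ D' →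
      D' ≤ 2 * D → D ≤ x ^ (1 + c) →
      |∑ d ∈ Fintype.piFinset (fun _ : Fin k => Finset.Icc 1 ⌊D'⌋₊),
          (if D < ∏ i, (d i : ℝ) ∧ ∏ i, (d i : ℝ) ≤ D' then
            (∏ i, ((ArithmeticFunction.moebius (d i) : ℝ) * Real.log (d i))) *
              (((((Finset.Icc 1 ⌊x⌋₊).filter (fun n : ℕ =>
                  ∀ i, d i ∈ (((f i).eval (n : ℤ)).toNat).divisors)).card : ℕ) : ℝ) -
                x * Summit.Parity.BatemanHorn.Theorems.TypeIMainTerm.sysDensity f d)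
          else 0)| ≤ x / Real.log x ^ A := by
  sorry

/-- **Composition of the piece (PROVED): W1 → W2 → W3 → `WindowNonlinearUniform`.**  Cases on the number of
members: `k = 0` is vacuous (no member of degree `≥ 2`), `k = 1` is W1 applied to W2 (the member of degree `≥ 2`
is `f 0`), `k ≥ 2` is W1 applied to W3.  Hypotheses are the three stub signatures verbatim. -/
theorem WindowNonlinearUniform_of
    (hW1 : ∀ (k : ℕ) (f : Fin k → ℤ[X]), IsBatemanHornSystem f →
      (∃ i, 2 ≤ (f i).natDegree) →
      (∃ c : ℝ, 0 < c ∧ ∃ A : ℝ, 1 < A ∧ ∃ x₀ : ℝ, ∀ x D D' : ℝ, x₀ ≤ x → x ^ (1 - c) ≤ D → D ≤ D' →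
          D' ≤ 2 * D → D ≤ x ^ (1 + c) →
          |∑ d ∈ Fintype.piFinset (fun _ : Fin k => Finset.Icc 1 ⌊D'⌋₊),
              (if D < ∏ i, (d i : ℝ) ∧ ∏ i, (d i : ℝ) ≤ D' then
                (∏ i, ((ArithmeticFunction.moebius (d i) : ℝ) * Real.log (d i))) *
                  (((((Finset.Icc 1 ⌊x⌋₊).filter (fun n : ℕ =>
                      ∀ i, d i ∈ (((f i).eval (n : ℤ)).toNat).divisors)).card : ℕ) : ℝ) -
                    x * Summit.Parity.BatemanHorn.Theorems.TypeIMainTerm.sysDensity f d)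
              else 0)| ≤ x / Real.log x ^ A) →
      ∃ c : ℝ, 0 < c ∧ c < 1 ∧ ∀ θ η : ℝ, 0 < θ → θ ≤ c → 0 < η → η ≤ c →
        (fun x : ℕ => ∑ n ∈ Finset.Icc 1 x,
          ∑ d ∈ Fintype.piFinset (fun i => (((f i).eval (n : ℤ)).toNat).divisors),
            if (x : ℝ) ^ (1 - η) < ∏ i, (d i : ℝ) ∧ ∏ i, (d i : ℝ) ≤ (x : ℝ) ^ (1 + θ) then
              ∏ i, ((ArithmeticFunction.moebius (d i) : ℝ) * Real.log (d i)) else 0)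
          =o[atTop] fun x : ℕ => (x : ℝ))
    (hW2 : ∀ (f : Fin 1 → ℤ[X]), IsBatemanHornSystem f → 2 ≤ (f 0).natDegree →
      ∃ c : ℝ, 0 < c ∧ ∃ A : ℝ, 1 < A ∧ ∃ x₀ : ℝ, ∀ x D D' : ℝ, x₀ ≤ x → x ^ (1 - c) ≤ D → D ≤ D' →
        D' ≤ 2 * D → D ≤ x ^ (1 + c) →
        |∑ d ∈ Fintype.piFinset (fun _ : Fin 1 => Finset.Icc 1 ⌊D'⌋₊),
            (if D < ∏ i, (d i : ℝ) ∧ ∏ i, (d i : ℝ) ≤ D' then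
              (∏ i, ((ArithmeticFunction.moebius (d i) : ℝ) * Real.log (d i))) *
                (((((Finset.Icc 1 ⌊x⌋₊).filter (fun n : ℕ =>
                    ∀ i, d i ∈ (((f i).eval (n : ℤ)).toNat).divisors)).card : ℕ) : ℝ) -
                  x * Summit.Parity.BatemanHorn.Theorems.TypeIMainTerm.sysDensity f d)
            else 0)| ≤ x / Real.log x ^ A)
    (hW3 : ∀ (k : ℕ) (f : Fin k → ℤ[X]), IsBatemanHornSystem f → 2 ≤ k →
      (∃ i, 2 ≤ (f i).natDegree) →
      ∃ c : ℝ, 0 < c ∧ ∃ A : ℝ, 1 < A ∧ ∃ x₀ : ℝ, ∀ x D D' : ℝ, x₀ ≤ x → x ^ (1 - c) ≤ D → D ≤ D' →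
        D' ≤ 2 * D → D ≤ x ^ (1 + c) →
        |∑ d ∈ Fintype.piFinset (fun _ : Fin k => Finset.Icc 1 ⌊D'⌋₊),
            (if D < ∏ i, (d i : ℝ) ∧ ∏ i, (d i : ℝ) ≤ D' then
              (∏ i, ((ArithmeticFunction.moebius (d i) : ℝ) * Real.log (d i))) *
                (((((Finset.Icc 1 ⌊x⌋₊).filter (fun n : ℕ =>
                    ∀ i, d i ∈ (((f i).eval (n : ℤ)).toNat).divisors)).card : ℕ) : ℝ) -
                  x * Summit.Parity.BatemanHorn.Theorems.TypeIMainTerm.sysDensity f d)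
            else 0)| ≤ x / Real.log x ^ A) :
    WindowNonlinearUniform := by
  intro k f hf hi
  by_cases hk : 2 ≤ k
  · exact hW1 k f hf hi (hW3 k f hf hk hi)
  · obtain ⟨i, hi⟩ := hi
    have hk' : k = 0 ∨ k = 1 := by omega
    rcases hk' with rfl | rfl
    · exact i.elim0
    · have h0 : 2 ≤ (f 0).natDegree := by
        have hi0 : i = 0 := Fin.fin_one_eq_zero i
        rw [hi0] at hi
        exact hi
      exact hW1 1 f hf ⟨0, h0⟩ (hW2 f hf h0)

/-- **The live (v6) registered form S3u `stub_window_nonlinear_uniform`, now DERIVED from W1–W3** (signature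
verbatim the record on stmt-Parity-0870; not a stub any more). -/
theorem windowNonlinearUniform_derived : ∀ (k : ℕ) (f : Fin k → ℤ[X]), IsBatemanHornSystem f →
    (∃ i, 2 ≤ (f i).natDegree) →
    ∃ c : ℝ, 0 < c ∧ c < 1 ∧ ∀ θ η : ℝ, 0 < θ → θ ≤ c → 0 < η → η ≤ c →
      (fun x : ℕ => ∑ n ∈ Finset.Icc 1 x,
        ∑ d ∈ Fintype.piFinset (fun i => (((f i).eval (n : ℤ)).toNat).divisors),
          if (x : ℝ) ^ (1 - η) < ∏ i, (d i : ℝ) ∧ ∏ i, (d i : ℝ) ≤ (x : ℝ) ^ (1 + θ) then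
            ∏ i, ((ArithmeticFunction.moebius (d i) : ℝ) * Real.log (d i)) else 0)
        =o[atTop] fun x : ℕ => (x : ℝ) :=
  WindowNonlinearUniform_of W1_nonlinear_window_of_level_landed stub_single_nonlinear_level
    stub_multi_nonlinear_level

/-- **The piece `stub_window_nonlinear` (v5 registered signature verbatim), DERIVED.** -/
theorem windowNonlinear_derived : ∀ (k : ℕ) (f : Fin k → ℤ[X]), IsBatemanHornSystem f →
    (∃ i, 2 ≤ (f i).natDegree) → ∃ θ : ℝ, 0 < θ ∧ θ < 1 ∧ ∃ η : ℝ, 0 < η ∧ η < 1 ∧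
      (fun x : ℕ => ∑ n ∈ Finset.Icc 1 x,
        ∑ d ∈ Fintype.piFinset (fun i => (((f i).eval (n : ℤ)).toNat).divisors),
          if (x : ℝ) ^ (1 - η) < ∏ i, (d i : ℝ) ∧ ∏ i, (d i : ℝ) ≤ (x : ℝ) ^ (1 + θ) then
            ∏ i, ((ArithmeticFunction.moebius (d i) : ℝ) * Real.log (d i)) else 0)
        =o[atTop] fun x : ℕ => (x : ℝ) :=
  windowNonlinear_of_uniform windowNonlinearUniform_derived

/-- Book-keeping certificate: the two `def`s above are literally the derived theorems' statements. -/
example : WindowNonlinearUniform := windowNonlinearUniform_derived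
example : WindowNonlinear := windowNonlinear_derived

/-! ## §B  The crux-level skeleton (content = v6 `Lines/stub_large.lean`; S3u supplied by §A) -/

/-- **S4a′ · `stub_large_core_small` — the EXACT parity core (open; every system).**  VERBATIM the v6 registered
stub (lead c7): for every Bateman–Horn system there is `θ₀ = θ₀(f) ∈ (0,1)` such that for all `0 < θ ≤ θ₀` and
`0 < δ < θ` the cofactor large part of the Möbius tail on COMPLETE pencils is `o(x)`:
`Σ_{n≤x} Σ_{eᵢ ∣ fᵢ(n), ∏ fᵢ(n)/eᵢ > x^{1+θ}, ∏ eᵢ ≤ x^{1-δ}} ∏ μ(fᵢ(n)/eᵢ) log(fᵢ(n)/eᵢ) = o(x)`.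
Exact strength (landed): on every linear pair ⟺ the pair's `Λ`-Hardy–Littlewood asymptotic
(`CoreExact.coreSmall_iff_lambda_pair`; `(X, X+2)`: `coreSmall_twin_iff`; p158153
`CoreStrength.twinPrimeConjecture_of_stub_large_core`); for all systems, modulo the windows S2u/S3u and the band
S4b, ⟺ the crux (`CoreExact.polyMobiusTail_of_coreSmall` / `coreSmall_of_polyMobiusTail`).  Why it might fail:
only if Bateman–Horn (Λ-form) fails on some system; the risk is hardness (Selberg / Bombieri parity
indeterminacy: `Literature.Barriers.Parity.SelbergParityBarrier`, `FordFixedLevelBarrier`), not falsity.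
Size: XL (summit-in-kind).  Sources: BombieriAsymptoticSieve1976; Ford2005; arXiv:2008.09905 §1.3;
`Cruxes/PolyMobiusTail/STRATEGY-CENSUS.md` gen 4 D20; REPORT-c6, REPORT-c7. -/
theorem stub_large_core_small : ∀ (k : ℕ) (f : Fin k → ℤ[X]), IsBatemanHornSystem f →
    ∃ θ₀ : ℝ, 0 < θ₀ ∧ θ₀ < 1 ∧ ∀ θ δ : ℝ, 0 < θ → θ ≤ θ₀ → 0 < δ → δ < θ →
      (fun x : ℕ => ∑ n ∈ Finset.Icc 1 x,
        ∑ e ∈ Fintype.piFinset (fun i => (((f i).eval (n : ℤ)).toNat).divisors),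
          if (x : ℝ) ^ (1 + θ) < ∏ i, ((((f i).eval (n : ℤ)).toNat / e i : ℕ) : ℝ) ∧
              ∏ i, (e i : ℝ) ≤ (x : ℝ) ^ (1 - δ) then
            ∏ i, ((ArithmeticFunction.moebius (((f i).eval (n : ℤ)).toNat / e i) : ℝ) *
              Real.log ((((f i).eval (n : ℤ)).toNat / e i : ℕ) : ℝ)) else 0)
        =o[atTop] fun x : ℕ => (x : ℝ) := by
  sorry

/-- **S4b · `stub_large_band_three_le` — the HYPER-INCOMPLETE BAND, total degree `G ≥ 3` (open; VERBATIM the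
v5/v6 registered stub).**  For every Bateman–Horn system with `∑ deg fᵢ ≥ 3` and `0 < δ < θ < 1`:
`Σ_{n≤x} Σ_{eᵢ ∣ fᵢ(n), ∏ fᵢ(n)/eᵢ > x^{1+θ}, ∏ eᵢ > x^{1-δ}} ∏ μ(fᵢ(n)/eᵢ) log(fᵢ(n)/eᵢ) = o(x)`.
No complete variable on either factorisation side; parity-free in kind (open with `μ ↦ 1`: divisor-type
correlations at the Pólya–Vinogradov threshold, Blomer, Bull. LMS 49 (2017)); consistent with the random model (no
main term), so no cheap refutation.  For `G ≤ 2` the band is EMPTY (landed p154483).  Size: L/XL.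
Sources: Blomer2017; census gen 4 D20 / T12; arXiv:2008.09905 §1.3. -/
theorem stub_large_band_three_le : ∀ (k : ℕ) (f : Fin k → ℤ[X]), IsBatemanHornSystem f →
    3 ≤ ∑ i, (f i).natDegree → ∀ θ δ : ℝ, 0 < θ → θ < 1 → 0 < δ → δ < θ →
    (fun x : ℕ => ∑ n ∈ Finset.Icc 1 x,
      ∑ e ∈ Fintype.piFinset (fun i => (((f i).eval (n : ℤ)).toNat).divisors),
        if (x : ℝ) ^ (1 + θ) < ∏ i, ((((f i).eval (n : ℤ)).toNat / e i : ℕ) : ℝ) ∧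
            (x : ℝ) ^ (1 - δ) < ∏ i, (e i : ℝ) then
          ∏ i, ((ArithmeticFunction.moebius (((f i).eval (n : ℤ)).toNat / e i) : ℝ) *
            Real.log ((((f i).eval (n : ℤ)).toNat / e i : ℕ) : ℝ)) else 0)
      =o[atTop] fun x : ℕ => (x : ℝ) := by
  sorry

/-- **S2u · `stub_window_linear_three_le_uniform` — WINDOW, linear systems with `k ≥ 3`, uniform in the cut-offs
(open, parity-free; VERBATIM the v6 registered stub).**  For a Bateman–Horn system of `k ≥ 3` members of degree
`≤ 1` there is `c ∈ (0,1)` with `Σ_{n≤x} Σ_{dᵢ∣fᵢ(n), x^{1-η} < ∏dᵢ ≤ x^{1+θ}} ∏ μ(dᵢ) log dᵢ = o(x)` for ALL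
`θ, η ∈ (0,c]` (the form in which the `k ≤ 2` windows are theorems: `CoreExact.uniformWindow_of_le_one`,
`CoreStrength.window_linear_pair_uniform`).  Corner: Bombieri–Vinogradov template of p146909 with
coefficient-uniform pair estimates and CRT-varying residues; interior: cyclic trilinear Kloosterman fractions
with modulus-entangled numerators — not in print (census gen 4 S12a; `Cruxes/PolyMobiusTail/StrategistS1Sketch.lean`).
Size: XL.  Sources: DukeFriedlanderIwaniec1997; BarrierNotesIdeator4 §B20. -/
theorem stub_window_linear_three_le_uniform : ∀ (k : ℕ) (f : Fin k → ℤ[X]), IsBatemanHornSystem f →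
    3 ≤ k → (∀ i, (f i).natDegree ≤ 1) →
    ∃ c : ℝ, 0 < c ∧ c < 1 ∧ ∀ θ η : ℝ, 0 < θ → θ ≤ c → 0 < η → η ≤ c →
      (fun x : ℕ => ∑ n ∈ Finset.Icc 1 x,
        ∑ d ∈ Fintype.piFinset (fun i => (((f i).eval (n : ℤ)).toNat).divisors),
          if (x : ℝ) ^ (1 - η) < ∏ i, (d i : ℝ) ∧ ∏ i, (d i : ℝ) ≤ (x : ℝ) ^ (1 + θ) then
            ∏ i, ((ArithmeticFunction.moebius (d i) : ℝ) * Real.log (d i)) else 0)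
        =o[atTop] fun x : ℕ => (x : ℝ) := by
  sorry

/-- **Composition of the crux (PROVED modulo the six registered stubs; the proof is the LANDED
`CoreExact.polyMobiusTail_of_coreSmall`, p158707, with S3u supplied by §A).**  The crux of route
PolynomialMobius, BY NAME. -/
theorem PolyMobiusTail_of : Summit.Parity.BatemanHorn.Theses.PolynomialMobius.PolyMobiusTail :=
  CoreExact.polyMobiusTail_of_coreSmall stub_large_core_small stub_large_band_three_le
    stub_window_linear_three_le_uniform windowNonlinearUniform_derived

/-- The identical decl of route IsogenyRedei (and, verbatim, CyclotomicTower / CrossedSalie /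
GaussianFractions — the five routes sharing stmt-Parity-0870). -/
theorem PolyMobiusTail_of_isogenyRedei : Summit.Parity.BatemanHorn.Theses.IsogenyRedei.PolyMobiusTail :=
  PolyMobiusTail_of

/-- **The piece `stub_large` in its v6 form `LargeSmall` (DERIVED from S4a′ ∧ S4b ∧ landed S4c; v6 verbatim).** -/
theorem stub_large_small_derived : ∀ (k : ℕ) (f : Fin k → ℤ[X]), IsBatemanHornSystem f →
    ∃ θ₀ : ℝ, 0 < θ₀ ∧ θ₀ < 1 ∧ ∀ θ : ℝ, 0 < θ → θ ≤ θ₀ →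
      (fun x : ℕ => ∑ n ∈ Finset.Icc 1 x,
        ∑ e ∈ Fintype.piFinset (fun i => (((f i).eval (n : ℤ)).toNat).divisors),
          if (x : ℝ) ^ (1 + θ) < ∏ i, ((((f i).eval (n : ℤ)).toNat / e i : ℕ) : ℝ) then
            ∏ i, ((ArithmeticFunction.moebius (((f i).eval (n : ℤ)).toNat / e i) : ℝ) *
              Real.log ((((f i).eval (n : ℤ)).toNat / e i : ℕ) : ℝ)) else 0)
        =o[atTop] fun x : ℕ => (x : ℝ) := by
  intro k f hf
  obtain ⟨θ₀, h₀0, h₀1, hC⟩ := stub_large_core_small k f hf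
  refine ⟨θ₀, h₀0, h₀1, fun θ hθ0 hθle => ?_⟩
  have hθ1 : θ < 1 := lt_of_le_of_lt hθle h₀1
  have hCore := hC θ (θ / 2) hθ0 hθle (by linarith) (by linarith)
  have hBand := CoreExact.band_of_pieces stub_large_band_three_le f hf θ (θ / 2) hθ0 hθ1
    (by linarith) (by linarith)
  exact (hCore.add hBand).congr_left fun x => (large_eq_core_add_band f θ (θ / 2) x).symm

/-- **Backward compatibility (v6 verbatim): the v5 stub S4a implies S4a′.** -/
theorem stub_large_core_small_of_forall
    (hS4a : ∀ (k : ℕ) (f : Fin k → ℤ[X]), IsBatemanHornSystem f → ∀ θ δ : ℝ,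
      0 < θ → θ < 1 → 0 < δ → δ < θ →
      (fun x : ℕ => ∑ n ∈ Finset.Icc 1 x,
        ∑ e ∈ Fintype.piFinset (fun i => (((f i).eval (n : ℤ)).toNat).divisors),
          if (x : ℝ) ^ (1 + θ) < ∏ i, ((((f i).eval (n : ℤ)).toNat / e i : ℕ) : ℝ) ∧
              ∏ i, (e i : ℝ) ≤ (x : ℝ) ^ (1 - δ) then
            ∏ i, ((ArithmeticFunction.moebius (((f i).eval (n : ℤ)).toNat / e i) : ℝ) *
              Real.log ((((f i).eval (n : ℤ)).toNat / e i : ℕ) : ℝ)) else 0)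
        =o[atTop] fun x : ℕ => (x : ℝ)) :
    ∀ (k : ℕ) (f : Fin k → ℤ[X]), IsBatemanHornSystem f →
      ∃ θ₀ : ℝ, 0 < θ₀ ∧ θ₀ < 1 ∧ ∀ θ δ : ℝ, 0 < θ → θ ≤ θ₀ → 0 < δ → δ < θ →
      (fun x : ℕ => ∑ n ∈ Finset.Icc 1 x,
        ∑ e ∈ Fintype.piFinset (fun i => (((f i).eval (n : ℤ)).toNat).divisors),
          if (x : ℝ) ^ (1 + θ) < ∏ i, ((((f i).eval (n : ℤ)).toNat / e i : ℕ) : ℝ) ∧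
              ∏ i, (e i : ℝ) ≤ (x : ℝ) ^ (1 - δ) then
            ∏ i, ((ArithmeticFunction.moebius (((f i).eval (n : ℤ)).toNat / e i) : ℝ) *
              Real.log ((((f i).eval (n : ℤ)).toNat / e i : ℕ) : ℝ)) else 0)
        =o[atTop] fun x : ℕ => (x : ℝ) :=
  fun k f hf => CoreExact.coreSmall_of_core_forall f (hS4a k f hf)

/-- **Exactness of v6 (landed, `CoreExact.coreSmall_of_polyMobiusTail`): modulo S2u ∧ S3u ∧ S4b the crux gives
S4a′ back** (S3u supplied by §A). -/
theorem stub_large_core_small_of_crux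
    (hTail : Summit.Parity.BatemanHorn.Theses.PolynomialMobius.PolyMobiusTail) :
    ∀ (k : ℕ) (f : Fin k → ℤ[X]), IsBatemanHornSystem f →
      ∃ θ₀ : ℝ, 0 < θ₀ ∧ θ₀ < 1 ∧ ∀ θ δ : ℝ, 0 < θ → θ ≤ θ₀ → 0 < δ → δ < θ →
      (fun x : ℕ => ∑ n ∈ Finset.Icc 1 x,
        ∑ e ∈ Fintype.piFinset (fun i => (((f i).eval (n : ℤ)).toNat).divisors),
          if (x : ℝ) ^ (1 + θ) < ∏ i, ((((f i).eval (n : ℤ)).toNat / e i : ℕ) : ℝ) ∧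
              ∏ i, (e i : ℝ) ≤ (x : ℝ) ^ (1 - δ) then
            ∏ i, ((ArithmeticFunction.moebius (((f i).eval (n : ℤ)).toNat / e i) : ℝ) *
              Real.log ((((f i).eval (n : ℤ)).toNat / e i : ℕ) : ℝ)) else 0)
        =o[atTop] fun x : ℕ => (x : ℝ) :=
  CoreExact.coreSmall_of_polyMobiusTail hTail stub_large_band_three_le
    stub_window_linear_three_le_uniform windowNonlinearUniform_derived

/-! ## §C  Summit equivalence (landed certificate p161759 / p161885, lead c8) -/

/-- **The crux is the summit conjunct** (landed `SummitEquivalence.polyMobiusTail_iff_batemanHorn`):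
`PolyMobiusTail ↔ BatemanHorn` (count form, Bateman–Horn 1962 (1), by name). -/
theorem PolyMobiusTail_iff_batemanHorn :
    Summit.Parity.BatemanHorn.Theses.PolynomialMobius.PolyMobiusTail ↔ _root_.BatemanHorn :=
  Summit.Parity.BatemanHorn.Theorems.PolyMobiusTail.SummitEquivalence.polyMobiusTail_iff_batemanHorn

/-- **The five registered stubs prove the SUMMIT conjunct `BatemanHorn`** (composition `PolyMobiusTail_of`
followed by the certificate). -/
theorem batemanHorn_of_stubs : _root_.BatemanHorn :=
  PolyMobiusTail_iff_batemanHorn.mp PolyMobiusTail_of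

/-- **Exactness at summit level: `BatemanHorn` gives the core stub S4a′ back modulo W2 ∧ W3 ∧ S2u ∧ S4b**
(certificate `←` then `stub_large_core_small_of_crux`). -/
theorem stub_large_core_small_of_batemanHorn (hBH : _root_.BatemanHorn) :
    ∀ (k : ℕ) (f : Fin k → ℤ[X]), IsBatemanHornSystem f →
      ∃ θ₀ : ℝ, 0 < θ₀ ∧ θ₀ < 1 ∧ ∀ θ δ : ℝ, 0 < θ → θ ≤ θ₀ → 0 < δ → δ < θ →
      (fun x : ℕ => ∑ n ∈ Finset.Icc 1 x,
        ∑ e ∈ Fintype.piFinset (fun i => (((f i).eval (n : ℤ)).toNat).divisors),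
          if (x : ℝ) ^ (1 + θ) < ∏ i, ((((f i).eval (n : ℤ)).toNat / e i : ℕ) : ℝ) ∧
              ∏ i, (e i : ℝ) ≤ (x : ℝ) ^ (1 - δ) then
            ∏ i, ((ArithmeticFunction.moebius (((f i).eval (n : ℤ)).toNat / e i) : ℝ) *
              Real.log ((((f i).eval (n : ℤ)).toNat / e i : ℕ) : ℝ)) else 0)
        =o[atTop] fun x : ℕ => (x : ℝ) :=
  stub_large_core_small_of_crux (PolyMobiusTail_iff_batemanHorn.mpr hBH)

end Summit.Parity.BatemanHorn.Cruxes.PolyMobiusTail.NonlinearWindow
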